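import Literature.NumberTheory.Automorphic.SmoothProjector
import HarnessLib

/-!
# An admissible PRE-UNITARY smooth representation has an IRREDUCIBLE subrepresentation through every non-zero
# space of compact-open fixed vectors (no finite-length theory)

Topic `NumberTheory/Automorphic`; namespace `Literature.NumberTheory.Automorphic.AdmissiblePreunitary`.  THEOREMS ONLY; imports ★
`SmoothProjector` (the averaging projector `e_K` = `avg`, Bernstein–Zelevinsky §2.3).

THE LEMMA (`exists_irreducible_submodule`).  Let `ρ` be a SMOOTH representation of a topological group `G` on a complex vector space
`V`, carrying a `G`-INVARIANT, DEFINITE sesquilinear form `B` (`B (ρ g v) (ρ g w) = B v w`, `B v v = 0 → v = 0` — e.g. the restriction of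
the `L²` inner product to an algebraic subrepresentation of a unitary representation), and let `K ≤ G` be a compact subgroup whose
fixed vectors `V^K` are FINITE-DIMENSIONAL and NON-ZERO (admissibility at `K`).  Then `V` contains a `G`-stable subspace `U ≠ 0` with NO
`G`-stable subspace strictly between `0` and `U`, and `U ∩ V^K ≠ 0`.

PROOF (the classical «minimal `K`-level» argument, [BernsteinZelevinsky1976, §2.1–2.3]; [Bump1997, §4.2, Prop. 4.2.3]; [Casselman1995,
Prop. 2.1.9], with unitarity replacing finite length).  Among the `G`-stable `U₁` with `U₁ ∩ V^K ≠ 0` choose one with `dim (U₁ ∩ V^K) = d`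
MINIMAL; put `W := U₁ ∩ V^K` and `U := Σ_g ρ(g) W`.  (a) `U ∩ V^K = W`: the projector `e_K` (★ `avg`) maps `ρ(g) W` into
`U₁ ∩ V^K = W` (`U₁` is stable and `e_K` is an average of `ρ(k)`, `k ∈ K`), and `e_K = id` on `V^K`.  (b) If `U′ ≤ U` is stable and
`U′ ∩ V^K ≠ 0`, minimality forces `U′ ∩ V^K = W`, so `U′ ⊇ U`.  (c) If `U′ ∩ V^K = 0`: for `u′ ∈ U′` and `w ∈ W`,
`B u′ w = B (e_K u′) w` (invariance of `B`, `w` is `K`-fixed) and `e_K u′ ∈ U′ ∩ V^K = 0`, so `U′ ⊥ W`, hence `U′ ⊥ ρ(g) W` for all `g`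
(invariance again), `U′ ⊥ U ⊇ U′`, and definiteness gives `U′ = 0`.  No complete-reducibility ∕ finite-length theorem is used.
Written for the floor-0 P2 (C)-desk stub CL «irreducible local type at a finite place» (F0P2-plan (g3) line `F0_P2CohFinComponentIsThetaC`;
F0P2-p03 (g2)), where `ρ = σ^{Kᵛ}|_{U(J)(F_v)}` for `σ ⊂ L²_disc`.  HC_CM is proved only modulo the printed citations until rung 0 closes.

## References
* [BernsteinZelevinsky1976] I. N. Bernstein, A. V. Zelevinsky, Russian Math. Surveys 31:3 (1976), §2.1–2.3 (smooth and admissible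
  representations, the projectors `e_K`, `V = V^K ⊕ V(K)`).
* [Bump1997] D. Bump, *Automorphic Forms and Representations* (1997), §4.2, Prop. 4.2.3 (irreducible `V` ↔ simple `V^K` over `ℋ_K`).
-/

set_option autoImplicit false

noncomputable section

namespace Literature.NumberTheory.Automorphic.AdmissiblePreunitary

open _root_.Representation Literature.NumberTheory.Automorphic.SmoothProjector

variable {G V : Type*} [Group G] [TopologicalSpace G] [IsTopologicalGroup G] [AddCommGroup V] [Module ℂ V]
  {ρ : Representation ℂ G V}

/-! ## §1 The averaging projector preserves stable subspaces; `K`-fixed vectors of an orbit span -/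

/-- **`e_K` preserves every `G`-stable subspace**: for `U₁` stable under all `ρ g`, `x ∈ U₁` smooth and `K` compact, `e_K x ∈ U₁`
(`e_K x` is a finite average of the `ρ(k) x`). [cite: BernsteinZelevinsky1976, §2.3] -/
theorem avg_mem_of_stable {K : Subgroup G} (hK : IsCompact (K : Set G)) {U₁ : Submodule ℂ V}
    (hU₁ : ∀ g : G, U₁.map (ρ g) ≤ U₁) {x : V} (hxU : x ∈ U₁) (hx : ρ.IsSmoothVector x) :
    avg ρ K x ∈ U₁ := by
  haveI := finiteIndex_stabIn hK hx
  haveI : Fintype (K ⧸ stabIn ρ K x) := Fintype.ofFinite _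
  rw [avg_eq_index_inv_smul_finsum (stabIn ρ K x) le_rfl, finsum_eq_sum_of_fintype]
  exact Submodule.smul_mem _ _ (Submodule.sum_mem _ fun q _ => hU₁ _ (Submodule.mem_map_of_mem hxU))

/-- **Invariant sesquilinear forms see through `e_K` against `K`-fixed vectors**: `B (e_K u) w = B u w` for `w ∈ V^K`, `u` smooth,
`K` compact (each `B (ρ k u) w = B u (ρ k⁻¹ w) = B u w`). [cite: BernsteinZelevinsky1976, §2.3] -/
theorem form_avg_left_eq {K : Subgroup G} (hK : IsCompact (K : Set G)) (B : V →ₗ⋆[ℂ] V →ₗ[ℂ] ℂ)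
    (hBinv : ∀ (g : G) (v w : V), B (ρ g v) (ρ g w) = B v w) {u w : V} (hu : ρ.IsSmoothVector u)
    (hw : w ∈ ρ.fixedPoints K) : B (avg ρ K u) w = B u w := by
  haveI := finiteIndex_stabIn hK hu
  haveI : Fintype (K ⧸ stabIn ρ K u) := Fintype.ofFinite _
  have hterm : ∀ q : K ⧸ stabIn ρ K u, B (ρ ((q.out : K) : G) u) w = B u w := by
    intro q
    have hk : ((q.out : K) : G) ∈ K := (q.out : K).2
    have hw' : ρ (((q.out : K) : G)⁻¹) w = w := (ρ.mem_fixedPoints K w).1 hw _ (inv_mem hk)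
    calc B (ρ ((q.out : K) : G) u) w
        = B (ρ ((q.out : K) : G) u) (ρ ((q.out : K) : G) (ρ (((q.out : K) : G)⁻¹) w)) := by
          rw [← Module.End.mul_apply, ← map_mul, mul_inv_cancel, map_one, Module.End.one_apply]
      _ = B u (ρ (((q.out : K) : G)⁻¹) w) := hBinv _ _ _
      _ = B u w := by rw [hw']
  rw [avg_eq_index_inv_smul_finsum (stabIn ρ K u) le_rfl, finsum_eq_sum_of_fintype, LinearMap.map_smulₛₗ₂, map_sum,
    LinearMap.sum_apply]
  simp_rw [hterm]
  rw [Finset.sum_const, Finset.card_univ, Fintype.card_eq_nat_card, ← Subgroup.index_eq_card, nsmul_eq_mul, smul_eq_mul,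
    ← mul_assoc]
  have hn : ((stabIn ρ K u).index : ℂ) ≠ 0 := Nat.cast_ne_zero.2 Subgroup.FiniteIndex.index_ne_zero
  rw [map_inv₀, map_natCast, inv_mul_cancel₀ hn, one_mul]

/-! ## §2 The irreducible subrepresentation through a minimal `K`-level -/

omit [TopologicalSpace G] [IsTopologicalGroup G] in
/-- The `G`-span `Σ_g ρ(g) W` of a subspace is `G`-stable. [cite: BernsteinZelevinsky1976, §2.1] -/
theorem map_iSup_map_le (W : Submodule ℂ V) (g : G) :
    (⨆ h : G, W.map (ρ h)).map (ρ g) ≤ ⨆ h : G, W.map (ρ h) := by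
  rw [Submodule.map_iSup]
  refine iSup_le fun h => ?_
  rw [← Submodule.map_comp, ← Module.End.mul_eq_comp, ← map_mul]
  exact le_iSup (fun h : G => W.map (ρ h)) (g * h)

/-- **THE LEMMA.**  For a smooth representation `ρ` with a `G`-invariant definite sesquilinear form and a compact open `K` with `V^K`
finite-dimensional and non-zero (`K` compact; openness is not even needed), there is a `G`-stable `U ≠ 0` meeting `V^K`, with no `G`-stable subspace strictly between `0` and
`U` — an IRREDUCIBLE subrepresentation. [cite: BernsteinZelevinsky1976, §2.1–2.3] [cite: Bump1997, §4.2, Prop. 4.2.3] -/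
theorem exists_irreducible_submodule (hρ : ρ.IsSmooth) (B : V →ₗ⋆[ℂ] V →ₗ[ℂ] ℂ)
    (hBinv : ∀ (g : G) (v w : V), B (ρ g v) (ρ g w) = B v w) (hBdef : ∀ v : V, B v v = 0 → v = 0)
    {K : Subgroup G} (hKc : IsCompact (K : Set G))
    (hfin : Module.Finite ℂ (ρ.fixedPoints K)) (hne : ρ.fixedPoints K ≠ ⊥) :
    ∃ U : Submodule ℂ V, U ≠ ⊥ ∧ U ⊓ ρ.fixedPoints K ≠ ⊥ ∧ (∀ g : G, U.map (ρ g) ≤ U) ∧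
      ∀ U' : Submodule ℂ V, U' ≤ U → (∀ g : G, U'.map (ρ g) ≤ U') → U' = ⊥ ∨ U' = U := by
  classical
  set F : Submodule ℂ V := ρ.fixedPoints K with hF
  haveI : Module.Finite ℂ F := hfin
  -- the `K`-level of a subspace, read INSIDE the finite-dimensional `F`
  let lev : Submodule ℂ V → Submodule ℂ F := fun U => (U ⊓ F).comap F.subtype
  have lev_mono : ∀ {U U' : Submodule ℂ V}, U ≤ U' → lev U ≤ lev U' := fun h =>
    Submodule.comap_mono (inf_le_inf_right F h)
  have mem_lev : ∀ (U : Submodule ℂ V) (x : F), x ∈ lev U ↔ (x : V) ∈ U := fun U x => by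
    simp only [lev, Submodule.mem_comap, Submodule.subtype_apply, Submodule.mem_inf, x.2, and_true]
  have lev_eq_bot_iff : ∀ U : Submodule ℂ V, lev U = ⊥ ↔ U ⊓ F = ⊥ := by
    intro U
    constructor
    · intro h
      rw [eq_bot_iff]
      intro x hx
      have hx' : (⟨x, hx.2⟩ : F) ∈ lev U := (mem_lev U ⟨x, hx.2⟩).2 hx.1
      rw [h, Submodule.mem_bot] at hx'
      exact (Submodule.mem_bot ℂ).2 (congrArg Subtype.val hx')
    · intro h
      rw [eq_bot_iff]
      intro x hx
      have : (x : V) ∈ U ⊓ F := ⟨(mem_lev U x).1 hx, x.2⟩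
      rw [h, Submodule.mem_bot] at this
      exact (Submodule.mem_bot ℂ).2 (Subtype.ext this)
  -- admissible levels: those of stable subspaces meeting `F`
  let P : ℕ → Prop := fun n => ∃ U : Submodule ℂ V, (∀ g : G, U.map (ρ g) ≤ U) ∧ lev U ≠ ⊥ ∧
    Module.finrank ℂ (lev U) = n
  have hP : ∃ n, P n := ⟨_, ⊤, fun g => le_top, by
    rw [Ne, lev_eq_bot_iff, top_inf_eq]; exact hne, rfl⟩
  obtain ⟨U₁, hU₁st, hU₁ne, hU₁d⟩ := Nat.find_spec hP
  have hmin : ∀ U : Submodule ℂ V, (∀ g : G, U.map (ρ g) ≤ U) → lev U ≠ ⊥ →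
      Module.finrank ℂ (lev U₁) ≤ Module.finrank ℂ (lev U) := fun U hU hUne => by
    rw [hU₁d]; exact Nat.find_min' hP ⟨U, hU, hUne, rfl⟩
  -- `W := U₁ ∩ F`, `U := Σ_g ρ(g) W`
  set W : Submodule ℂ V := U₁ ⊓ F with hW
  set U : Submodule ℂ V := ⨆ g : G, W.map (ρ g) with hU
  have hWU : W ≤ U := by
    have h : W.map (ρ 1) ≤ U := le_iSup (fun g : G => W.map (ρ g)) 1
    intro w hw
    exact h ⟨w, hw, by rw [map_one]; rfl⟩
  have hUU₁ : U ≤ U₁ := iSup_le fun g => (Submodule.map_mono inf_le_left).trans (hU₁st g)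
  have hUst : ∀ g : G, U.map (ρ g) ≤ U := fun g => map_iSup_map_le W g
  -- (a) `U ∩ F = W`
  have hlevU : U ⊓ F = W := by
    refine le_antisymm ?_ (le_inf hWU inf_le_right)
    rintro u ⟨huU, huF⟩
    -- `e_K` maps `U` into `W`
    have hmap : U.map (avgLinear K hρ hKc) ≤ W := by
      rw [hU, Submodule.map_iSup]
      refine iSup_le fun g => ?_
      rw [Submodule.map_le_iff_le_comap]
      rintro _ ⟨w, hw, rfl⟩
      refine ⟨avg_mem_of_stable hKc hU₁st (hU₁st g (Submodule.mem_map_of_mem hw.1)) (hρ _), ?_⟩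
      exact avg_mem_fixedPoints hKc (hρ _)
    have h1 : avg ρ K u = u := avg_eq_self_of_mem_fixedPoints huF
    have h2 : avg ρ K u ∈ W := hmap ⟨u, huU, rfl⟩
    rw [h1] at h2
    exact h2
  refine ⟨U, fun h0 => ?_, fun h0 => hU₁ne ?_, hUst, fun U' hU'U hU'st => ?_⟩
  · -- `U ≠ 0` since `W ≠ 0`
    apply hU₁ne
    rw [lev_eq_bot_iff, ← hW]
    exact eq_bot_iff.2 (h0 ▸ hWU)
  · rw [lev_eq_bot_iff, ← hW, ← hlevU]; exact h0
  · by_cases hU'F : lev U' = ⊥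
    · -- (c) `U′ ∩ F = 0` ⇒ `U′ ⊥ U` ⇒ `U′ = 0`
      left
      rw [lev_eq_bot_iff] at hU'F
      have horthW : ∀ u' ∈ U', ∀ w ∈ W, B u' w = 0 := by
        intro u' hu' w hw
        have havg0 : avg ρ K u' = 0 := by
          have hmem : avg ρ K u' ∈ U' ⊓ F :=
            ⟨avg_mem_of_stable hKc hU'st hu' (hρ _), avg_mem_fixedPoints hKc (hρ _)⟩
          rw [hU'F, Submodule.mem_bot] at hmem
          exact hmem
        rw [← form_avg_left_eq hKc B hBinv (hρ u') hw.2, havg0, LinearMap.map_zero₂]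
      have horthU : ∀ u' ∈ U', ∀ u ∈ U, B u' u = 0 := by
        intro u' hu'
        have hker : U ≤ LinearMap.ker (B u') := by
          rw [hU]
          refine iSup_le fun g => ?_
          rw [Submodule.map_le_iff_le_comap]
          intro w hw
          show B u' (ρ g w) = 0
          have hinv : B u' (ρ g w) = B (ρ g⁻¹ u') w := by
            conv_lhs => rw [show u' = ρ g (ρ g⁻¹ u') by
              rw [← Module.End.mul_apply, ← map_mul, mul_inv_cancel, map_one, Module.End.one_apply]]
            exact hBinv g _ _
          rw [hinv]
          exact horthW _ (hU'st g⁻¹ (Submodule.mem_map_of_mem hu')) w hw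
        exact fun u hu => hker hu
      rw [eq_bot_iff]
      intro u' hu'
      exact (Submodule.mem_bot ℂ).2 (hBdef u' (horthU u' hu' u' (hU'U hu')))
    · -- (b) `U′ ∩ F ≠ 0` ⇒ `U′ ∩ F = W` ⇒ `U′ = U`
      right
      have hle : lev U' ≤ lev U := lev_mono hU'U
      have hlevUW : lev U = lev U₁ := by
        show (U ⊓ F).comap F.subtype = (U₁ ⊓ F).comap F.subtype
        rw [hlevU, hW]
      have hdim : Module.finrank ℂ (lev U) ≤ Module.finrank ℂ (lev U') := by
        rw [hlevUW]; exact hmin U' hU'st hU'F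
      have heq : lev U' = lev U := Submodule.eq_of_le_of_finrank_le hle hdim
      -- hence `W ≤ U′`
      have hWU' : W ≤ U' := by
        intro w hw
        have hw' : (⟨w, hw.2⟩ : F) ∈ lev U := (mem_lev U ⟨w, hw.2⟩).2 (hWU hw)
        rw [← heq] at hw'
        exact (mem_lev U' ⟨w, hw.2⟩).1 hw'
      refine le_antisymm hU'U ?_
      rw [hU]
      exact iSup_le fun g => (Submodule.map_mono hWU').trans (hU'st g)

end Literature.NumberTheory.Automorphic.AdmissiblePreunitary

end
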